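import Mathlib
import HarnessLib
import Summits.NavierStokesRegularity.NavierStokesRegularity.Theorems.ThreadingFluxHorizonTowerL2DegreeTwo
import Summits.NavierStokesRegularity.NavierStokesRegularity.Theorems.UnthreadedDoorAntidynamoLocalLaplacianProduct
import Summits.NavierStokesRegularity.NavierStokesRegularity.Theorems.UnthreadedDoorAntidynamoRadialToroidalLaplacian

/-!
# Route `UnthreadedDoor` / `ThreadingFlux`, crux `PoloidalLiouville` (stmt-NavierStokesRegularity-1222), antidynamo v2 skeleton,
# rung `stub_singleDegreeRung`, EVEN degree — (E1c) THE STRAIN KILL: boundedness of the slice removes the linear remainder `T•y` of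
# the kinematic normal form (`T = κ·∇P` for `l = 2`, absorbed into `k`; `T = 0` for `l ≥ 3`)

Support file (census instrument decomp-ns-census-1 g34, cell decomp-ns; `--supports stmt-NavierStokesRegularity-1222 --as helper`; 0 kit).

PURE LEMMA.  After (E1a) (p813766, radial profiles `a, k`) and (E1b) (harmonic remainder affine), a non-constant even slice reads
`u(x₀ + y) = (a(r)P(y))•y + k(r)•∇P(y) + b + T y` with `T : ℝ³ →L ℝ³` SYMMETRIC (curl-free remainder) and TRACE-FREE (divergence-free
remainder).  THIS FILE shows that BOUNDEDNESS of `u` alone forces `T•y = κ•∇P(y)` — so `T` is absorbed into `k` (and `κ = 0`, `T = 0`, when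
`l ≥ 3`).  Only the RADIAL reading is used: `⟪u(x₀+y) − b, y⟫ = m(r)·P(y) + ⟪Ty, y⟫` with SOME scalar `m` (here `m = a r² + l k`, by Euler), and
`|⟪u − b, y⟫| ≤ M‖y‖`:

* ★ `quadForm_eq_mul_on_sphere_of_radial_bound` — eliminating `m(r)` between two directions `u, u₁ ∈ S²` (`P(u₁) ≠ 0`):
  `|q(u)P(u₁) − q(u₁)P(u)| ≤ M(|P u₁| + |P u|)/r` for every `r > 0`, hence `q = c₀·P` on `S²` (`q(y) = ⟪Ty, y⟫`, `c₀ = q(u₁)/P(u₁)`); no limits;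
* `quadForm_mul_pow_eq` — homogenised: `⟪Ty, y⟫·‖y‖^l = c₀·P(y)·‖y‖²` on `ℝ³`;
* ★ `clm_eq_smul_gradient_of_quadForm_eq` (`l = 2`) — `⟪Ty,y⟫ = c₀P(y)` with `T` symmetric ⟹ `T y = (c₀/2)•∇P(y)` (differentiate);
* ★ `clm_eq_zero_of_quadForm_mul_pow_eq` (`l ≥ 3`) — `T` symmetric trace-free, `P ∈ C²` harmonic: on `{0}ᶜ`, `q·r^{l−2} = c₀P` is harmonic, while
  `Δ(q·r^{l−2}) = (l−2)·[6 r^{l−3}/r + (l−3) r^{l−4}]·q` (`Δq = 2 tr T = 0`, `HorizonTower.laplacian_quadForm_eq_trace`; product rule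
  `laplacian_smul_field_of_contDiffOn`; radial calculus `laplacian_and_gradient_radial`) with a POSITIVE bracket ⟹ `q ≡ 0` ⟹ `T = 0`;
* ★★ `strainKill` — THE EXPORT: `P ∈ C²` positively homogeneous of degree `l ≥ 2`, harmonic, `P ≢ 0`; `T` symmetric trace-free; `w` bounded with
  `⟪w y, y⟫ = m(‖y‖)P(y) + ⟪Ty, y⟫` ⟹ `∃ κ, ∀ y, T y = κ•∇P(y)` (and `T = 0` if `l ≥ 3`).

HONEST LABEL: elementary (homogeneity along rays, one differentiation, one Laplacian) serving the open EVEN-degree rung of an S-free Liouville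
engine; the rung, the wall `stub_scalarLiouville`, `PoloidalLiouville` (1222) and Navier–Stokes regularity are NOT touched (crux 1222 is
INCOMPARABLE with the summit; descent inside the door's cone, decorative for the summit).  Nothing here proves NavierStokesRegularity. [folklore]
-/

noncomputable section

-- the summit and its single sub-problem share the name (CONVENTIONS §1), as in every Theorems file
set_option linter.dupNamespace false

open scoped Topology InnerProductSpace RealInnerProductSpace ContDiff Laplacian
open Filter Set Metric
open Literature.Analysis.FluidPDE

namespace Summit.NavierStokesRegularity.NavierStokesRegularity.Theorems.PoloidalLiouville.Antidynamo

open Summit.NavierStokesRegularity.NavierStokesRegularity.Theorems.PoloidalLiouville.HorizonTower (laplacian_quadForm_eq_trace contDiff_quadForm)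

/-! ### The radial reading on spheres -/

/-- A real number bounded by `A/r` for every `r > 0` vanishes. [folklore] -/
theorem eq_zero_of_abs_le_div {x A : ℝ} (h : ∀ r : ℝ, 0 < r → |x| ≤ A / r) : x = 0 := by
  by_contra hx
  have hxpos : 0 < |x| := abs_pos.mpr hx
  have hA : 0 ≤ A := by
    have := h 1 one_pos
    rw [div_one] at this
    exact hxpos.le.trans this
  have hr : 0 < (A + 1) / |x| * 2 := by positivity
  have key := h _ hr
  rw [le_div_iff₀ hr] at key
  have : |x| * ((A + 1) / |x| * 2) = 2 * (A + 1) := by field_simp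
  rw [this] at key
  linarith

/-- ★ **THE RADIAL READING.**  Let `P` be positively homogeneous of degree `l ≥ 1` with `P ≢ 0`, `T : ℝ³ →L ℝ³`, and `w` a BOUNDED field
whose radial component reads `⟪w y, y⟫ = m(‖y‖)·P(y) + ⟪T y, y⟫` for some scalar function `m`.  Then the quadratic form of `T` is a
multiple of `P` on the unit sphere: `∃ c₀, ∀ u ∈ S², ⟪Tu, u⟫ = c₀ P(u)`.  [Eliminate `m(r)` between the readings at `r•u` and `r•u₁`
(`P u₁ ≠ 0`): `r²|q(u)P(u₁) − q(u₁)P(u)| ≤ M r (|P u₁| + |P u|)` for all `r > 0`.] [folklore] -/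
theorem quadForm_eq_mul_on_sphere_of_radial_bound {P : EuclideanSpace ℝ (Fin 3) → ℝ} {l : ℕ} (hl : 1 ≤ l)
    (hhom : ∀ r : ℝ, 0 < r → ∀ y : EuclideanSpace ℝ (Fin 3), P (r • y) = r ^ l * P y) (hP0 : ∃ y, P y ≠ 0)
    (T : EuclideanSpace ℝ (Fin 3) →L[ℝ] EuclideanSpace ℝ (Fin 3)) {w : EuclideanSpace ℝ (Fin 3) → EuclideanSpace ℝ (Fin 3)} {M : ℝ}
    (hM : ∀ y, ‖w y‖ ≤ M) {m : ℝ → ℝ} (hrad : ∀ y, ⟪w y, y⟫ = m ‖y‖ * P y + ⟪T y, y⟫) :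
    ∃ c₀ : ℝ, ∀ u : EuclideanSpace ℝ (Fin 3), ‖u‖ = 1 → ⟪T u, u⟫ = c₀ * P u := by
  -- a unit vector with `P u₁ ≠ 0`
  obtain ⟨y₁, hy₁⟩ := hP0
  have hy₁0 : y₁ ≠ 0 := by
    intro h
    rw [h] at hy₁
    have h2 := hhom 2 two_pos (0 : EuclideanSpace ℝ (Fin 3))
    rw [smul_zero] at h2
    have : (2 : ℝ) ^ l = 1 := by
      have h3 : P 0 * ((2 : ℝ) ^ l - 1) = 0 := by linarith
      rcases mul_eq_zero.mp h3 with h4 | h4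
      · exact absurd h4 hy₁
      · linarith
    have h5 : (1 : ℝ) < 2 ^ l := one_lt_pow₀ (by norm_num) (by omega)
    linarith
  have hn₁ : 0 < ‖y₁‖ := norm_pos_iff.mpr hy₁0
  set u₁ : EuclideanSpace ℝ (Fin 3) := ‖y₁‖⁻¹ • y₁ with hu₁
  have hu₁1 : ‖u₁‖ = 1 := by rw [hu₁, norm_smul, norm_inv, norm_norm, inv_mul_cancel₀ hn₁.ne']
  have hPu₁ : P u₁ ≠ 0 := by
    rw [hu₁, hhom _ (inv_pos.mpr hn₁) y₁]
    exact mul_ne_zero (pow_ne_zero _ (inv_ne_zero hn₁.ne')) hy₁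
  -- the reading along a ray
  have hray : ∀ u : EuclideanSpace ℝ (Fin 3), ‖u‖ = 1 → ∀ r : ℝ, 0 < r →
      |m r * r ^ l * P u + r ^ 2 * ⟪T u, u⟫| ≤ M * r := by
    intro u hu r hr
    have hn : ‖r • u‖ = r := by rw [norm_smul, Real.norm_eq_abs, abs_of_pos hr, hu, mul_one]
    have h1 : ⟪w (r • u), r • u⟫ = m r * r ^ l * P u + r ^ 2 * ⟪T u, u⟫ := by
      rw [hrad, hn, hhom r hr u, map_smul, inner_smul_left, inner_smul_right, conj_trivial]
      ring
    have h2 : |⟪w (r • u), r • u⟫| ≤ M * r := by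
      calc |⟪w (r • u), r • u⟫| ≤ ‖w (r • u)‖ * ‖r • u‖ := abs_real_inner_le_norm _ _
        _ ≤ M * r := by rw [hn]; exact mul_le_mul_of_nonneg_right (hM _) hr.le
    rw [h1] at h2
    exact h2
  refine ⟨⟪T u₁, u₁⟫ / P u₁, fun u hu => ?_⟩
  -- eliminate `m r`
  have hkey : ⟪T u, u⟫ * P u₁ - ⟪T u₁, u₁⟫ * P u = 0 := by
    refine eq_zero_of_abs_le_div (A := M * (|P u₁| + |P u|)) fun r hr => ?_
    have h1 := hray u hu r hr
    have h2 := hray u₁ hu₁1 r hr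
    rw [le_div_iff₀ hr]
    have hr2 : 0 < r ^ 2 := pow_pos hr 2
    -- `r² (q(u)P(u₁) − q(u₁)P(u)) = P(u₁)·(ray u) − P(u)·(ray u₁)`
    have e : (⟪T u, u⟫ * P u₁ - ⟪T u₁, u₁⟫ * P u) * r ^ 2 =
        P u₁ * (m r * r ^ l * P u + r ^ 2 * ⟪T u, u⟫) - P u * (m r * r ^ l * P u₁ + r ^ 2 * ⟪T u₁, u₁⟫) := by ring
    have h3 : |⟪T u, u⟫ * P u₁ - ⟪T u₁, u₁⟫ * P u| * r ^ 2 ≤ M * (|P u₁| + |P u|) * r := by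
      rw [← abs_of_pos hr2, ← abs_mul, e]
      calc |P u₁ * (m r * r ^ l * P u + r ^ 2 * ⟪T u, u⟫) - P u * (m r * r ^ l * P u₁ + r ^ 2 * ⟪T u₁, u₁⟫)|
          ≤ |P u₁ * (m r * r ^ l * P u + r ^ 2 * ⟪T u, u⟫)| + |P u * (m r * r ^ l * P u₁ + r ^ 2 * ⟪T u₁, u₁⟫)| := abs_sub _ _
        _ = |P u₁| * |m r * r ^ l * P u + r ^ 2 * ⟪T u, u⟫| + |P u| * |m r * r ^ l * P u₁ + r ^ 2 * ⟪T u₁, u₁⟫| := by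
            rw [abs_mul, abs_mul]
        _ ≤ |P u₁| * (M * r) + |P u| * (M * r) := by gcongr
        _ = M * (|P u₁| + |P u|) * r := by ring
    -- divide by `r`
    have h4 : |⟪T u, u⟫ * P u₁ - ⟪T u₁, u₁⟫ * P u| * r ≤ M * (|P u₁| + |P u|) := by
      have := h3
      rw [pow_two, ← mul_assoc] at this
      exact le_of_mul_le_mul_right this hr
    exact h4
  field_simp
  linarith

/-- Homogenised form: `⟪Ty, y⟫·‖y‖^l = c₀·P(y)·‖y‖²` on all of `ℝ³`. [folklore] -/
theorem quadForm_mul_pow_eq {P : EuclideanSpace ℝ (Fin 3) → ℝ} {l : ℕ} (hl : 1 ≤ l)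
    (hhom : ∀ r : ℝ, 0 < r → ∀ y : EuclideanSpace ℝ (Fin 3), P (r • y) = r ^ l * P y)
    (T : EuclideanSpace ℝ (Fin 3) →L[ℝ] EuclideanSpace ℝ (Fin 3)) {c₀ : ℝ}
    (hS : ∀ u : EuclideanSpace ℝ (Fin 3), ‖u‖ = 1 → ⟪T u, u⟫ = c₀ * P u) (y : EuclideanSpace ℝ (Fin 3)) :
    ⟪T y, y⟫ * ‖y‖ ^ l = c₀ * P y * ‖y‖ ^ 2 := by
  by_cases hy : y = 0
  · subst hy
    simp [zero_pow (by omega : l ≠ 0)]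
  · have hr : 0 < ‖y‖ := norm_pos_iff.mpr hy
    set u : EuclideanSpace ℝ (Fin 3) := ‖y‖⁻¹ • y with hu
    have hu1 : ‖u‖ = 1 := by rw [hu, norm_smul, norm_inv, norm_norm, inv_mul_cancel₀ hr.ne']
    have hyu : y = ‖y‖ • u := by rw [hu, smul_smul, mul_inv_cancel₀ hr.ne', one_smul]
    have h := hS u hu1
    have hPy : P y = ‖y‖ ^ l * P u := by
      conv_lhs => rw [hyu]
      exact hhom _ hr u
    have hTy : ⟪T y, y⟫ = ‖y‖ ^ 2 * ⟪T u, u⟫ := by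
      conv_lhs => rw [hyu]
      rw [map_smul, inner_smul_left, inner_smul_right, conj_trivial]
      ring
    rw [hTy, hPy, h]
    ring

/-! ### `l = 2`: the strain is a multiple of `∇P` -/

/-- ★ `l = 2`: if `⟪Ty, y⟫ = c₀ P(y)` for all `y`, `T` symmetric and `P` differentiable, then `T y = (c₀/2)•∇P(y)` (differentiate both
sides: `2⟪Ty, h⟫ = c₀⟪∇P(y), h⟫`). [folklore] -/
theorem clm_eq_smul_gradient_of_quadForm_eq {P : EuclideanSpace ℝ (Fin 3) → ℝ} (hP : Differentiable ℝ P)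
    (T : EuclideanSpace ℝ (Fin 3) →L[ℝ] EuclideanSpace ℝ (Fin 3)) (hTs : ∀ y z, ⟪T y, z⟫ = ⟪y, T z⟫) {c₀ : ℝ}
    (hq : ∀ y, ⟪T y, y⟫ = c₀ * P y) (y : EuclideanSpace ℝ (Fin 3)) : T y = (c₀ / 2) • gradient P y := by
  -- derivative of the quadratic form
  have hD : HasFDerivAt (fun z : EuclideanSpace ℝ (Fin 3) => ⟪T z, z⟫)
      ((fderivInnerCLM ℝ (T y, y)).comp (T.prod (ContinuousLinearMap.id ℝ _))) y :=
    T.hasFDerivAt.inner ℝ (hasFDerivAt_id y)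
  -- derivative of `c₀ P`
  have hD' : HasFDerivAt (fun z : EuclideanSpace ℝ (Fin 3) => c₀ * P z) (c₀ • fderiv ℝ P y) y :=
    ((hP y).hasFDerivAt).const_mul c₀
  have hfun : (fun z : EuclideanSpace ℝ (Fin 3) => ⟪T z, z⟫) = fun z => c₀ * P z := funext hq
  rw [hfun] at hD
  have heq := hD.unique hD'
  -- evaluate at `h`
  have key : ∀ h : EuclideanSpace ℝ (Fin 3), 2 * ⟪T y, h⟫ = c₀ * ⟪gradient P y, h⟫ := by
    intro h
    have := DFunLike.congr_fun heq h
    rw [ContinuousLinearMap.comp_apply, ContinuousLinearMap.prod_apply, fderivInnerCLM_apply,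
      ContinuousLinearMap.id_apply, show (c₀ • fderiv ℝ P y) h = c₀ * fderiv ℝ P y h from rfl] at this
    rw [gradient, InnerProductSpace.toDual_symm_apply, ← this, hTs h y, real_inner_comm]
    ring
  -- conclude
  have h0 : ⟪T y - (c₀ / 2) • gradient P y, T y - (c₀ / 2) • gradient P y⟫ = 0 := by
    have h1 := key (T y - (c₀ / 2) • gradient P y)
    rw [inner_sub_left, inner_smul_left, conj_trivial]
    linarith
  exact sub_eq_zero.mp (inner_self_eq_zero.mp h0)

/-! ### `l ≥ 3`: the strain vanishes -/

/-- A symmetric operator with vanishing quadratic form is zero. [folklore] -/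
theorem clm_eq_zero_of_quadForm_eq_zero (T : EuclideanSpace ℝ (Fin 3) →L[ℝ] EuclideanSpace ℝ (Fin 3))
    (hTs : ∀ y z, ⟪T y, z⟫ = ⟪y, T z⟫) (hq : ∀ y, ⟪T y, y⟫ = 0) : T = 0 := by
  refine ContinuousLinearMap.ext fun y => ?_
  have h1 := hq (y + T y)
  rw [map_add, inner_add_left, inner_add_right, inner_add_right, hq y, hq (T y), hTs (T y) y] at h1
  have h2 : ⟪T y, T y⟫ = 0 := by linarith
  exact inner_self_eq_zero.mp h2

/-- ★ `l ≥ 3`: `T` symmetric and trace-free, `P ∈ C²` harmonic, and `⟪Ty, y⟫·‖y‖^l = c₀·P(y)·‖y‖²` on `ℝ³` ⟹ `T = 0`.  [On `{0}ᶜ` the function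
`q·r^{l−2}` (`q(y) = ⟪y, Ty⟫`) equals `c₀P`, hence is harmonic; but `Δ(q·r^{l−2}) = (l−2)(6 r^{l−3}/r + (l−3) r^{l−4})·q` with a positive
bracket, so `q ≡ 0`.] [folklore] -/
theorem clm_eq_zero_of_quadForm_mul_pow_eq {P : EuclideanSpace ℝ (Fin 3) → ℝ} (hP : ContDiff ℝ 2 P)
    (hharm : ∀ y, (Δ P) y = 0) {l : ℕ} (hl : 3 ≤ l)
    (T : EuclideanSpace ℝ (Fin 3) →L[ℝ] EuclideanSpace ℝ (Fin 3)) (hTs : ∀ y z, ⟪T y, z⟫ = ⟪y, T z⟫)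
    (hTtr : LinearMap.trace ℝ _ (T : EuclideanSpace ℝ (Fin 3) →ₗ[ℝ] EuclideanSpace ℝ (Fin 3)) = 0) {c₀ : ℝ}
    (hq : ∀ y : EuclideanSpace ℝ (Fin 3), ⟪T y, y⟫ * ‖y‖ ^ l = c₀ * P y * ‖y‖ ^ 2) : T = 0 := by
  refine clm_eq_zero_of_quadForm_eq_zero T hTs fun y => ?_
  by_cases hy : y = 0
  · rw [hy, map_zero, inner_zero_left]
  have hr : 0 < ‖y‖ := norm_pos_iff.mpr hy
  -- the two factors on `U = {0}ᶜ`
  set U : Set (EuclideanSpace ℝ (Fin 3)) := {0}ᶜ with hU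
  have hUo : IsOpen U := isOpen_compl_singleton
  have hyU : y ∈ U := hy
  set H : ℝ → ℝ := fun r => r ^ (l - 2) with hH
  have hH2 : ContDiffOn ℝ 2 H (Ioi 0) := (contDiff_id.pow _).contDiffOn
  have hφ : ContDiffOn ℝ 2 (fun w : EuclideanSpace ℝ (Fin 3) => H ‖w‖) U := by
    intro w hw
    have hw0 : w ≠ 0 := hw
    exact ((hH2.contDiffAt (Ioi_mem_nhds (norm_pos_iff.2 hw0))).comp w (contDiffAt_norm ℝ hw0)).contDiffWithinAt
  have hqs : ContDiff ℝ 2 (fun w : EuclideanSpace ℝ (Fin 3) => ⟪w, T w⟫) := (contDiff_quadForm T).of_le (by norm_cast)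
  -- `q·r^{l−2} = c₀ P` near `y`
  have hloc : (fun w : EuclideanSpace ℝ (Fin 3) => H ‖w‖ • ⟪w, T w⟫) =ᶠ[𝓝 y] fun w => c₀ * P w := by
    filter_upwards [hUo.mem_nhds hyU] with w hw
    have hw0 : w ≠ 0 := hw
    have hwn : 0 < ‖w‖ := norm_pos_iff.2 hw0
    have h := hq w
    have hpow : ‖w‖ ^ l = ‖w‖ ^ (l - 2) * ‖w‖ ^ 2 := by rw [← pow_add]; congr 1; omega
    rw [hpow, real_inner_comm] at h
    rw [smul_eq_mul, hH]
    have h2 : (‖w‖ ^ (l - 2) * ⟪w, T w⟫ - c₀ * P w) * ‖w‖ ^ 2 = 0 := by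
      have := h; ring_nf; ring_nf at this; linarith
    rcases mul_eq_zero.mp h2 with h3 | h3
    · linarith
    · exact absurd h3 (pow_ne_zero 2 hwn.ne')
  -- Laplacians
  have hΔR : (Δ fun w : EuclideanSpace ℝ (Fin 3) => c₀ * P w) y = 0 := by
    have : (fun w : EuclideanSpace ℝ (Fin 3) => c₀ * P w) = c₀ • P := by funext w; rfl
    rw [this, InnerProductSpace.laplacian_smul _ hP.contDiffAt, hharm y, smul_zero]
  have hΔL := laplacian_smul_field_of_contDiffOn (F' := ℝ) hUo hφ hqs.contDiffOn hyU
  rw [(InnerProductSpace.laplacian_congr_nhds hloc).eq_of_nhds, hΔR, laplacian_quadForm_eq_trace T y, hTtr, mul_zero, smul_zero,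
    zero_add] at hΔL
  obtain ⟨hΔφ, hgradφ⟩ := laplacian_and_gradient_radial hH2 hy
  rw [hΔφ, hgradφ] at hΔL
  -- derivative of the quadratic form in the direction `y`: `Dq(y)[y] = 2 q(y)`
  have hDq : fderiv ℝ (fun w : EuclideanSpace ℝ (Fin 3) => ⟪w, T w⟫) y y = 2 * ⟪y, T y⟫ := by
    have hD : HasFDerivAt (fun z : EuclideanSpace ℝ (Fin 3) => ⟪z, T z⟫)
        ((fderivInnerCLM ℝ (y, T y)).comp ((ContinuousLinearMap.id ℝ _).prod T)) y :=
      (hasFDerivAt_id y).inner ℝ T.hasFDerivAt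
    rw [hD.fderiv, ContinuousLinearMap.comp_apply, ContinuousLinearMap.prod_apply, fderivInnerCLM_apply,
      ContinuousLinearMap.id_apply]
    ring
  -- the derivatives of `H`
  have hH1 : deriv H ‖y‖ = ((l - 2 : ℕ) : ℝ) * ‖y‖ ^ (l - 3) := by
    rw [hH, deriv_pow_field]
    congr 2
  have hH2' : deriv (deriv H) ‖y‖ = ((l - 2 : ℕ) : ℝ) * (((l - 3 : ℕ) : ℝ) * ‖y‖ ^ (l - 4)) := by
    have : deriv H = fun r => ((l - 2 : ℕ) : ℝ) * r ^ (l - 3) := by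
      funext r; rw [hH, deriv_pow_field]; congr 2
    rw [this, deriv_const_mul_field, deriv_pow_field]
    congr 3
  rw [map_smul, hDq, hH1, hH2', smul_eq_mul, smul_eq_mul, smul_eq_mul] at hΔL
  -- `hΔL : 0 = 2 * ((l-2) r^{l-3} / r * (2 q)) + ((l-2)(l-3) r^{l-4} + 2 (l-2) r^{l-3}/r) * q`
  have hl2 : (0 : ℝ) < ((l - 2 : ℕ) : ℝ) := by
    have : 1 ≤ l - 2 := by omega
    exact_mod_cast this
  have hl3 : (0 : ℝ) ≤ ((l - 3 : ℕ) : ℝ) := by positivity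
  have hbr : 0 < 2 * (((l - 2 : ℕ) : ℝ) * ‖y‖ ^ (l - 3) / ‖y‖ * 2) +
      (((l - 2 : ℕ) : ℝ) * (((l - 3 : ℕ) : ℝ) * ‖y‖ ^ (l - 4)) + 2 * (((l - 2 : ℕ) : ℝ) * ‖y‖ ^ (l - 3)) / ‖y‖) := by
    positivity
  have hprod : (2 * (((l - 2 : ℕ) : ℝ) * ‖y‖ ^ (l - 3) / ‖y‖ * 2) +
      (((l - 2 : ℕ) : ℝ) * (((l - 3 : ℕ) : ℝ) * ‖y‖ ^ (l - 4)) + 2 * (((l - 2 : ℕ) : ℝ) * ‖y‖ ^ (l - 3)) / ‖y‖)) * ⟪y, T y⟫ = 0 := by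
    rw [← sub_eq_zero] at hΔL
    have := hΔL
    ring_nf
    ring_nf at this
    linarith
  rcases mul_eq_zero.mp hprod with h | h
  · exact absurd h hbr.ne'
  · rw [real_inner_comm]; exact h

/-! ### ★★ The export -/

/-- ★★ **THE STRAIN KILL.**  Let `P ∈ C²(ℝ³)` be positively homogeneous of degree `l ≥ 2`, harmonic, `P ≢ 0`; `T : ℝ³ →L ℝ³` symmetric and
trace-free; `w` a BOUNDED field whose radial component reads `⟪w y, y⟫ = m(‖y‖)·P(y) + ⟪Ty, y⟫` for some scalar `m`.  Then `T•y = κ•∇P(y)`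
for a constant `κ` (and `T = 0` when `l ≥ 3`).  USE (even rung of 1222): `w y = u(x₀+y) − b` for a bounded slice in kinematic normal form
`u(x₀+y) = (aP)•y + k•∇P + b + Ty`, `m = a r² + l k` — the strain `T` is absorbed into `k`. [folklore] -/
theorem strainKill {P : EuclideanSpace ℝ (Fin 3) → ℝ} (hP : ContDiff ℝ 2 P) {l : ℕ} (hl : 2 ≤ l)
    (hhom : ∀ r : ℝ, 0 < r → ∀ y : EuclideanSpace ℝ (Fin 3), P (r • y) = r ^ l * P y)
    (hharm : ∀ y, (Δ P) y = 0) (hP0 : ∃ y, P y ≠ 0)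
    (T : EuclideanSpace ℝ (Fin 3) →L[ℝ] EuclideanSpace ℝ (Fin 3)) (hTs : ∀ y z, ⟪T y, z⟫ = ⟪y, T z⟫)
    (hTtr : LinearMap.trace ℝ _ (T : EuclideanSpace ℝ (Fin 3) →ₗ[ℝ] EuclideanSpace ℝ (Fin 3)) = 0)
    {w : EuclideanSpace ℝ (Fin 3) → EuclideanSpace ℝ (Fin 3)} {M : ℝ} (hM : ∀ y, ‖w y‖ ≤ M) {m : ℝ → ℝ}
    (hrad : ∀ y, ⟪w y, y⟫ = m ‖y‖ * P y + ⟪T y, y⟫) :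
    (∃ κ : ℝ, ∀ y, T y = κ • gradient P y) ∧ (3 ≤ l → T = 0) := by
  have hl1 : 1 ≤ l := by omega
  obtain ⟨c₀, hc₀⟩ := quadForm_eq_mul_on_sphere_of_radial_bound hl1 hhom hP0 T hM hrad
  have hhomq := quadForm_mul_pow_eq hl1 hhom T hc₀
  have h3 : 3 ≤ l → T = 0 := fun h3 => clm_eq_zero_of_quadForm_mul_pow_eq hP hharm h3 T hTs hTtr hhomq
  refine ⟨?_, h3⟩
  rcases Nat.lt_or_ge l 3 with h2 | h3'
  · obtain rfl : l = 2 := by omega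
    refine ⟨c₀ / 2, clm_eq_smul_gradient_of_quadForm_eq (hP.differentiable (by norm_num)) T hTs fun y => ?_⟩
    have h := hhomq y
    by_cases hy : y = 0
    · subst hy
      have hP00 : P 0 = 0 := by
        have h2 := hhom 2 two_pos (0 : EuclideanSpace ℝ (Fin 3))
        rw [smul_zero] at h2
        linarith
      rw [map_zero, inner_zero_left, hP00, mul_zero]
    · have hr : 0 < ‖y‖ ^ 2 := pow_pos (norm_pos_iff.mpr hy) 2
      exact mul_right_cancel₀ hr.ne' h
  · exact ⟨0, fun y => by rw [h3 h3', zero_smul]; rfl⟩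

end Summit.NavierStokesRegularity.NavierStokesRegularity.Theorems.PoloidalLiouville.Antidynamo

end
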